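import Summits.MatrixMultiplication.OmegaCensus.STPPNearPeriodFilter

/-!
# ω-census (abelian STPP census): filter N12 — the SYMMETRIC near-period CLOSURE filter (kernel)

HONEST FRAMING (pub-omega census; verbatim): lottery ticket; floor = certified bounds/negative ranges.
Census BOOKKEEPING (seat pub-omega-stpp-1 gen 26, 2026-08-27), family (b2).  A necessary condition on STPP families in finite
abelian groups — a tool for EXCLUDING candidate patterns of the finite census by theorem; nothing here is progress on `ω`.

## Statement

Let `(Aᵢ, Bᵢ, Cᵢ)_{i<N}` be an STPP family (CKSU 2005 Def. 5.1, the tree's `IsSTPP`) with non-empty sets in a finite abelian group `H`,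
`|H| = n`; `X = ⋃ᵢ(Bᵢ − Aᵢ)`, `Y = ⋃ᵢ(Cᵢ − Bᵢ)`, `Z = ⋃ᵢ(Cᵢ − Aᵢ)` (`|X| = Σaᵢbᵢ`, `|Y| = Σbᵢcᵢ`, `|Z| = Σaᵢcᵢ`, `STPPKneserFilter.lean` §2),
`V = Σ aᵢbᵢcᵢ`, `tₐ = max aᵢ`, `t_c = max cᵢ`.  Def. 5.1 gives `rep X Y = b_j` on `Z_j` (`rep_eq_card_B`, so `Σ_{z∈Z} rep X Y z = V`) and
the translate counts T1/T2 (`card_filter_add_mem_le_card_A/_C`), whence the NEAR-PERIODS (`le_dif_of_translate_add_le`):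
`dif X δ ≥ σ := 2|X| − 2tₐ − (n − |Z|)` for `δ ∈ Y − Y` and `dif Y δ ≥ σ' := 2|Y| − 2t_c − (n − |Z|)` for `δ ∈ X − X`.

**Theorem (filter N12).**  If `σ ≥ 1`, `σ' ≥ 1` and (`2σ > |X|` or `2σ' > |Y|`) then `D := X − X = Y − Y` (a near-period is a
difference), every `δ ∈ D` has `dif X δ ≥ σ`, `dif Y δ ≥ σ'`, and `D + D ⊆ D` by the CLOSURE LEMMA `dif_add_pos_of_lt` (two subsets of `X`
of size `> |X|/2` meet — the pigeonhole behind Freiman's `3/2`-theorem; multiplicative twin `difR_mul_pos_of_lt` in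
`STPPNearPeriodAnyGroup.lean`); so `D` is a SUBGROUP, `e := #D` divides `n`, `X`, `Y` lie in single cosets and `X + Y ⊇ Z` in one coset:
(i) `max(|X|,|Y|,|Z|) ≤ e`; (ii) `|X||Y| ≤ V + (e − |Z|)·min(|X|,|Y|)` (mass: `rep` sums to `V` on `Z`, is `≤ min(|X|,|Y|)` elsewhere,
`card_mul_card_le_of_subset`); (iii) `(e − 1)σ + |X| ≤ |X|²`, `(e − 1)σ' + |Y| ≤ |Y|²` (energy, `card_sub_one_mul_add_card_le`).
A pattern is **N12-dead** at order `n` if for some rotation `(A,B,C) → (B,C,A) → (C,A,B)` the hypothesis holds and NO divisor `e` of `n`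
satisfies (i)–(iii) (`N12Dead`, a decidable card-vector predicate with the bounded divisor quantifier of `N8Dead` / `N11Dead`);
`not_isSTPP_of_n12Dead`.  No Kneser: where N11 (`STPPNearPeriodFilter.lean`) bounds `#(S' − S')` by Kneser with the stabilizer order
`d ∣ n`, N12 makes `#(X − X)` ITSELF a divisor of `n` that is `≥ |Z|`.

Measured bite (HOME `pub-omega-stpp-1-g26/n12/`, numbers only, paper-grade until re-derived by the census seat): ℤ₅₇ front of record
(820 leaves alive under N7+N8+N9): N10-dead 4; N11-dead 491; N12-dead 695; N11 ∪ N12 696; alive 120.  Soundness checks of the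
arithmetic (not of this file): 0 of 568 FEASIBLE (pattern, group) pairs of the abelian `≤ 16` census and 0 of 1 981 SAT-witnessed
patterns of orders 48–57 are N12-dead.

References: H. Cohn, R. Kleinberg, B. Szegedy, C. Umans, FOCS 2005 (arXiv:math/0511460), Def. 5.1; the closure lemma is folklore
(cf. T. Tao, "An elementary non-commutative Freiman theorem", 2009; Mathlib `Mathlib.Combinatorics.Additive.VerySmallDoubling`).
-/

open Finset
open scoped Pointwise

namespace Summit.MatrixMultiplication.OmegaCensus.CubeNB

variable {H : Type*} [AddCommGroup H] [DecidableEq H]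

/-! ## §1 Abstract: closure by pigeonhole, the mass count, the N12 contradiction -/

/-- Admissibility of a candidate subgroup order `e` for the N12 conclusions (i) and (iii): `sX, sY, sZ ≤ e` and the two energy
inequalities `(e − 1)σ + sX ≤ sX²`, `(e − 1)σ' + sY ≤ sY²` (Bool, decidable piecewise). [folklore] -/
def n12Adm (sX sY sZ σ σ' e : ℕ) : Bool :=
  decide (sX ≤ e) && decide (sY ≤ e) && decide (sZ ≤ e) && decide ((e - 1) * σ + sX ≤ sX * sX) &&
    decide ((e - 1) * σ' + sY ≤ sY * sY)

section Abstract

/-- **Closure by pigeonhole (additive).**  If `#X = m`, `2·dif X δ₁ > m` and `2·dif X δ₂ > m`, then `δ₁ + δ₂` is a difference of `X`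
with a positive count: some `x ∈ X` has `x − δ₂ ∈ X` and `x − δ₂ − δ₁ ∈ X`. (The device behind Freiman's `3/2`-theorem;
multiplicative form `difR_mul_pos_of_lt`.) [folklore] -/
theorem dif_add_pos_of_lt {X : Finset H} {m : ℕ} (hX : #X = m) {δ₁ δ₂ : H} (h1 : m < 2 * dif X δ₁)
    (h2 : m < 2 * dif X δ₂) : 0 < dif X (δ₁ + δ₂) := by
  set P := X.filter fun x => x - δ₁ ∈ X with hP
  set Q := (X.filter fun x => x - δ₂ ∈ X).image fun x => x - δ₂ with hQ
  have hPc : dif X δ₁ = #P := rfl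
  have hQc : #Q = dif X δ₂ := by rw [hQ, card_image_of_injective _ (sub_left_injective (b := δ₂))]; rfl
  have hQX : Q ⊆ X := fun x hx => by
    obtain ⟨x', hx', rfl⟩ := mem_image.1 hx
    exact (mem_filter.1 hx').2
  have hPQ : (P ∩ Q).Nonempty := by
    rw [← card_pos]
    have hu : #(P ∪ Q) ≤ m := hX ▸ card_le_card (union_subset (filter_subset _ _) hQX)
    have := card_union_add_card_inter P Q
    omega
  obtain ⟨x, hx⟩ := hPQ
  rw [mem_inter] at hx
  obtain ⟨hxP, hxQ⟩ := hx
  rw [hP, mem_filter] at hxP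
  obtain ⟨x', hx', rfl⟩ := mem_image.1 hxQ
  apply card_pos.2
  refine ⟨x', mem_filter.2 ⟨(mem_filter.1 hx').1, ?_⟩⟩
  have e : x' - (δ₁ + δ₂) = x' - δ₂ - δ₁ := by abel
  rw [e]; exact hxP.2

/-- A positive difference count exhibits the difference: `0 < dif S δ ⇒ δ ∈ S − S`. [folklore] -/
theorem mem_sub_of_dif_pos {S : Finset H} {δ : H} (h : 0 < dif S δ) : δ ∈ S - S := by
  obtain ⟨s, hs⟩ := card_pos.1 h
  rw [mem_filter] at hs
  exact mem_sub.2 ⟨s, hs.1, s - δ, hs.2, by abel⟩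

/-- A positive representation count exhibits the representation: `0 < rep X Y g ⇒ g = x + y`. [folklore] -/
theorem exists_eq_add_of_rep_pos {X Y : Finset H} {g : H} (h : 0 < rep X Y g) : ∃ x ∈ X, ∃ y ∈ Y, g = x + y := by
  obtain ⟨x, hx⟩ := card_pos.1 h
  rw [mem_filter] at hx
  exact ⟨x, hx.1, g - x, hx.2, by abel⟩

/-- **Mass count.**  If all sums `x + y` lie in `P ⊇ Z` and `Σ_{z ∈ Z} rep X Y z ≤ V`, then `|X||Y| ≤ V + (#P − #Z)·min(|X|,|Y|)`
(`Σ_g rep X Y g = |X||Y|`, `rep` vanishes off `P` and is `≤ min(|X|,|Y|)` pointwise). [folklore] -/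
theorem card_mul_card_le_of_subset [Fintype H] {X Y Z P : Finset H} (hXYP : ∀ x ∈ X, ∀ y ∈ Y, x + y ∈ P) (hZP : Z ⊆ P)
    {V : ℕ} (hV : ∑ z ∈ Z, rep X Y z ≤ V) : #X * #Y ≤ V + (#P - #Z) * min #X #Y := by
  have htot : ∑ g, rep X Y g = #X * #Y := sum_rep X Y
  have hsplit : ∑ g, rep X Y g = ∑ g ∈ P, rep X Y g := by
    rw [← sum_subset (subset_univ P)]
    intro g _ hg
    rw [rep, card_eq_zero, filter_eq_empty_iff]
    intro x hx hy
    exact hg (by have := hXYP x hx (g - x) hy; rwa [add_sub_cancel] at this)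
  have hPZ : ∑ g ∈ P, rep X Y g = ∑ g ∈ Z, rep X Y g + ∑ g ∈ P \ Z, rep X Y g := by
    rw [← sum_sdiff hZP, add_comm]
  have hrest : ∑ g ∈ P \ Z, rep X Y g ≤ (#P - #Z) * min #X #Y := by
    calc ∑ g ∈ P \ Z, rep X Y g ≤ ∑ g ∈ P \ Z, min #X #Y :=
          sum_le_sum fun g _ => le_min (rep_le_left X Y g) (rep_le_right X Y g)
      _ = (#P - #Z) * min #X #Y := by rw [sum_const, smul_eq_mul, card_sdiff_of_subset hZP]
  omega

variable [Fintype H]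

/-- **The N12 contradiction, abstract form.**  `X, Y, Z ⊆ H` with `|X| = sX`, `|Y| = sY`, `|Z| = sZ`, `Σ_{z∈Z} rep X Y z ≤ V`, every
`z ∈ Z` represented, column translate counts `≤ ta` and row translate counts `≤ tc`; `σ = 2sX + sZ − 2ta − n`, `σ' = 2sY + sZ − 2tc − n`.
If `σ, σ' ≥ 1`, (`2σ > sX` or `2σ' > sY`), and every divisor `e` of `n = |H|` with `sX, sY, sZ ≤ e` and the two energy inequalities
violates the mass inequality, contradiction (see the file header). [folklore] -/
theorem false_of_closure_hyp {X Y Z : Finset H} {n sX sY sZ V ta tc : ℕ} (hn : Fintype.card H = n) (hX : #X = sX)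
    (hY : #Y = sY) (hZ : #Z = sZ) (hV : ∑ z ∈ Z, rep X Y z ≤ V) (hZpos : ∀ z ∈ Z, 0 < rep X Y z)
    (hcol : ∀ y ∈ Y, #(X.filter fun x => x + y ∈ Z) ≤ ta) (hrow : ∀ x ∈ X, #(Y.filter fun y => y + x ∈ Z) ≤ tc)
    (hσ1 : 2 * ta + n + 1 ≤ 2 * sX + sZ) (hσ'1 : 2 * tc + n + 1 ≤ 2 * sY + sZ)
    (hbig : sX + 1 ≤ 2 * (2 * sX + sZ - (2 * ta + n)) ∨ sY + 1 ≤ 2 * (2 * sY + sZ - (2 * tc + n)))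
    (hall : ∀ e : ℕ, e < n + 1 → e ∣ n → 0 < e →
      n12Adm sX sY sZ (2 * sX + sZ - (2 * ta + n)) (2 * sY + sZ - (2 * tc + n)) e = true →
      V + (e - sZ) * min sX sY < sX * sY) : False := by
  -- the margins as honest naturals
  obtain ⟨σ, hσ⟩ : ∃ σ, 2 * sX + sZ = σ + (2 * ta + n) := ⟨2 * sX + sZ - (2 * ta + n), by omega⟩
  obtain ⟨σ', hσ'⟩ : ∃ σ', 2 * sY + sZ = σ' + (2 * tc + n) := ⟨2 * sY + sZ - (2 * tc + n), by omega⟩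
  have eσ : 2 * sX + sZ - (2 * ta + n) = σ := by omega
  have eσ' : 2 * sY + sZ - (2 * tc + n) = σ' := by omega
  rw [eσ, eσ'] at hbig
  simp only [eσ, eσ'] at hall
  have hσpos : 1 ≤ σ := by omega
  have hσ'pos : 1 ≤ σ' := by omega
  -- near-periods
  have hNPX : ∀ y ∈ Y, ∀ y' ∈ Y, σ ≤ dif X (y - y') := by
    intro y hy y' hy'
    have := le_dif_of_translate_add_le hcol hy hy'
    rw [hX, hZ, hn] at this
    omega
  have hNPY : ∀ x ∈ X, ∀ x' ∈ X, σ' ≤ dif Y (x - x') := by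
    intro x hx x' hx'
    have := le_dif_of_translate_add_le hrow hx hx'
    rw [hY, hZ, hn] at this
    omega
  -- sizes are positive
  have hsZn : sZ ≤ n := by rw [← hZ, ← hn]; exact card_le_univ Z
  have hXne : X.Nonempty := card_pos.1 (by omega)
  have hYne : Y.Nonempty := card_pos.1 (by omega)
  -- `D = X − X = Y − Y`
  set D := X - X with hDdef
  have hYYD : Y - Y ⊆ D := fun δ hδ => by
    obtain ⟨y, hy, y', hy', rfl⟩ := mem_sub.1 hδ
    exact mem_sub_of_dif_pos (by have := hNPX y hy y' hy'; omega)
  have hDYY : D ⊆ Y - Y := fun δ hδ => by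
    obtain ⟨x, hx, x', hx', rfl⟩ := mem_sub.1 hδ
    exact mem_sub_of_dif_pos (by have := hNPY x hx x' hx'; omega)
  have hDσ : ∀ δ ∈ D, σ ≤ dif X δ := fun δ hδ => by
    obtain ⟨y, hy, y', hy', rfl⟩ := mem_sub.1 (hDYY hδ)
    exact hNPX y hy y' hy'
  have hDσ' : ∀ δ ∈ D, σ' ≤ dif Y δ := fun δ hδ => by
    obtain ⟨x, hx, x', hx', rfl⟩ := mem_sub.1 hδ
    exact hNPY x hx x' hx'
  -- closure
  have hDadd : ∀ δ₁ ∈ D, ∀ δ₂ ∈ D, δ₁ + δ₂ ∈ D := by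
    intro δ₁ h₁ δ₂ h₂
    rcases hbig with hb | hb
    · exact mem_sub_of_dif_pos (dif_add_pos_of_lt hX (by have := hDσ δ₁ h₁; omega) (by have := hDσ δ₂ h₂; omega))
    · exact hYYD (mem_sub_of_dif_pos
        (dif_add_pos_of_lt hY (by have := hDσ' δ₁ h₁; omega) (by have := hDσ' δ₂ h₂; omega)))
  obtain ⟨x₀, hx₀⟩ := hXne
  obtain ⟨y₀, hy₀⟩ := hYne
  have h0D : (0 : H) ∈ D := mem_sub.2 ⟨x₀, hx₀, x₀, hx₀, sub_self x₀⟩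
  have hDneg : ∀ δ ∈ D, -δ ∈ D := fun δ hδ => by
    obtain ⟨x, hx, x', hx', rfl⟩ := mem_sub.1 hδ
    exact mem_sub.2 ⟨x', hx', x, hx, by abel⟩
  -- `D` is a subgroup, so `#D ∣ n`
  let K : AddSubgroup H :=
    { carrier := ↑D
      add_mem' := fun {u v} hu hv => hDadd u hu v hv
      zero_mem' := h0D
      neg_mem' := fun {u} hu => hDneg u hu }
  have hKcard : Nat.card K = #D := by
    rw [← Nat.card_eq_finsetCard]
    rfl
  have hdvd : #D ∣ n := by
    have := AddSubgroup.card_addSubgroup_dvd_card K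
    rwa [hKcard, Nat.card_eq_fintype_card, hn] at this
  -- (i) sizes at most `e = #D`
  have hXe : sX ≤ #D := by
    rw [← hX, ← card_image_of_injective X (sub_left_injective (b := x₀))]
    exact card_le_card fun d hd => by
      obtain ⟨x, hx, rfl⟩ := mem_image.1 hd
      exact mem_sub.2 ⟨x, hx, x₀, hx₀, rfl⟩
  have hYe : sY ≤ #D := by
    rw [← hY, ← card_image_of_injective Y (sub_left_injective (b := y₀))]
    exact card_le_card fun d hd => by
      obtain ⟨y, hy, rfl⟩ := mem_image.1 hd
      exact hYYD (mem_sub.2 ⟨y, hy, y₀, hy₀, rfl⟩)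
  set P := D.image (fun d => x₀ + y₀ + d) with hPdef
  have hPD : #P = #D := card_image_of_injective _ (add_right_injective (x₀ + y₀))
  have hXYP : ∀ x ∈ X, ∀ y ∈ Y, x + y ∈ P := by
    intro x hx y hy
    have h1 : x - x₀ ∈ D := mem_sub.2 ⟨x, hx, x₀, hx₀, rfl⟩
    have h2 : y - y₀ ∈ D := hYYD (mem_sub.2 ⟨y, hy, y₀, hy₀, rfl⟩)
    refine mem_image.2 ⟨x - x₀ + (y - y₀), hDadd _ h1 _ h2, by abel⟩
  have hZP : Z ⊆ P := fun z hz => by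
    obtain ⟨x, hx, y, hy, rfl⟩ := exists_eq_add_of_rep_pos (hZpos z hz)
    exact hXYP x hx y hy
  have hZe : sZ ≤ #D := by rw [← hZ, ← hPD]; exact card_le_card hZP
  -- (ii) mass, (iii) energies
  have hmass := card_mul_card_le_of_subset hXYP hZP hV
  rw [hX, hY, hZ, hPD] at hmass
  have hEX := card_sub_one_mul_add_card_le (S := X) h0D hDσ
  have hEY := card_sub_one_mul_add_card_le (S := Y) h0D hDσ'
  rw [hX] at hEX
  rw [hY] at hEY
  -- the divisor `e = #D` refutes `hall`
  have hDle : #D < n + 1 := by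
    have := card_le_univ D
    rw [hn] at this
    omega
  have hDpos : 0 < #D := card_pos.2 ⟨0, h0D⟩
  have hadm : n12Adm sX sY sZ σ σ' #D = true := by
    simp only [n12Adm, Bool.and_eq_true, decide_eq_true_eq]
    exact ⟨⟨⟨⟨hXe, hYe⟩, hZe⟩, hEX⟩, hEY⟩
  have := hall #D hDle hdvd hDpos hadm
  omega

end Abstract

/-! ## §2 The STPP interface: the volume identity and the one-rotation contradiction -/

section STPP

open Literature.Computability.AlgebraicComplexity

variable [Fintype H] {N : ℕ} {A B C : Fin N → Finset H}

omit [Fintype H] in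
/-- **Volume identity.**  `Σ_{z ∈ Z} rep X Y z = Σᵢ |Aᵢ||Bᵢ||Cᵢ|` for an STPP family with non-empty `Bᵢ` (`rep = |B_j|` on `Z_j`,
`|Z_j| = |A_j||C_j|`, the `Z_j` pairwise disjoint). [cite: CohnKleinbergSzegedyUmans2005, Def. 5.1] -/
theorem sum_rep_DU_AC (hS : IsSTPP A B C) (hB : ∀ i, (B i).Nonempty) :
    ∑ z ∈ STPPKneser.DU A C univ, rep (STPPKneser.DU A B univ) (STPPKneser.DU B C univ) z =
      ∑ i, #(A i) * #(B i) * #(C i) := by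
  rw [STPPKneser.DU, sum_biUnion (fun i _ j _ hij => STPPKneser.disjoint_D_AC hS hB hij)]
  refine sum_congr rfl fun i _ => ?_
  rw [sum_congr rfl fun z hz => rep_eq_card_B hS hz, sum_const, smul_eq_mul, STPPKneser.card_D_AC hS hB]
  ring

/-- **N12, one rotation (abstract card data).**  For an STPP family with non-empty sets: the data `|X| = Σaᵢbᵢ`, `|Y| = Σbᵢcᵢ`,
`|Z| = Σaᵢcᵢ`, `V = Σaᵢbᵢcᵢ`, `ta ≥ all aᵢ`, `tc ≥ all cᵢ` satisfy the hypotheses of `false_of_closure_hyp` as soon as the numeric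
N12 condition holds. [cite: CohnKleinbergSzegedyUmans2005, Def. 5.1] -/
theorem n12_rotation (hS : IsSTPP A B C) (hA : ∀ i, (A i).Nonempty) (hB : ∀ i, (B i).Nonempty) (hC : ∀ i, (C i).Nonempty)
    {n : ℕ} (hn : Fintype.card H = n) {a b c : Fin N → ℕ} (ha : ∀ i, #(A i) = a i) (hb : ∀ i, #(B i) = b i)
    (hc : ∀ i, #(C i) = c i) {ta tc : ℕ} (hta : ∀ i, a i ≤ ta) (htc : ∀ i, c i ≤ tc)
    (hσ1 : 2 * ta + n + 1 ≤ 2 * (∑ i, a i * b i) + ∑ i, a i * c i)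
    (hσ'1 : 2 * tc + n + 1 ≤ 2 * (∑ i, b i * c i) + ∑ i, a i * c i)
    (hbig : (∑ i, a i * b i) + 1 ≤ 2 * (2 * (∑ i, a i * b i) + (∑ i, a i * c i) - (2 * ta + n)) ∨
      (∑ i, b i * c i) + 1 ≤ 2 * (2 * (∑ i, b i * c i) + (∑ i, a i * c i) - (2 * tc + n)))
    (hall : ∀ e : ℕ, e < n + 1 → e ∣ n → 0 < e →
      n12Adm (∑ i, a i * b i) (∑ i, b i * c i) (∑ i, a i * c i) (2 * (∑ i, a i * b i) + (∑ i, a i * c i) - (2 * ta + n))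
        (2 * (∑ i, b i * c i) + (∑ i, a i * c i) - (2 * tc + n)) e = true →
      (∑ i, a i * b i * c i) + (e - ∑ i, a i * c i) * min (∑ i, a i * b i) (∑ i, b i * c i) <
        (∑ i, a i * b i) * (∑ i, b i * c i)) : False := by
  have hX : #(STPPKneser.DU A B univ) = ∑ i, a i * b i := by rw [STPPKneser.card_DU_AB hS hC]; simp_rw [ha, hb]
  have hY : #(STPPKneser.DU B C univ) = ∑ i, b i * c i := by rw [STPPKneser.card_DU_BC hS hA]; simp_rw [hb, hc]
  have hZ : #(STPPKneser.DU A C univ) = ∑ i, a i * c i := by rw [STPPKneser.card_DU_AC hS hB]; simp_rw [ha, hc]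
  have hV : ∑ z ∈ STPPKneser.DU A C univ, rep (STPPKneser.DU A B univ) (STPPKneser.DU B C univ) z ≤ ∑ i, a i * b i * c i := by
    rw [sum_rep_DU_AC hS hB]; simp_rw [ha, hb, hc]; exact le_rfl
  have hZpos : ∀ z ∈ STPPKneser.DU A C univ, 0 < rep (STPPKneser.DU A B univ) (STPPKneser.DU B C univ) z := by
    intro z hz
    obtain ⟨j, -, hz⟩ := mem_biUnion.1 hz
    rw [rep_eq_card_B hS hz]
    exact (hB j).card_pos
  have hcol : ∀ y ∈ STPPKneser.DU B C univ,
      #((STPPKneser.DU A B univ).filter fun x => x + y ∈ STPPKneser.DU A C univ) ≤ ta := by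
    intro y hy
    obtain ⟨l, -, hy⟩ := mem_biUnion.1 hy
    exact (card_filter_add_mem_le_card_A hS hy).trans (by rw [ha]; exact hta l)
  have hrow : ∀ x ∈ STPPKneser.DU A B univ,
      #((STPPKneser.DU B C univ).filter fun y => y + x ∈ STPPKneser.DU A C univ) ≤ tc := by
    intro x hx
    obtain ⟨l, -, hx⟩ := mem_biUnion.1 hx
    exact (card_filter_add_mem_le_card_C hS hx).trans (by rw [hc]; exact htc l)
  exact false_of_closure_hyp hn hX hY hZ hV hZpos hcol hrow hσ1 hσ'1 hbig hall

end STPP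

/-! ## §3 The decidable card-vector predicate and the filter theorem -/

section Filter

/-- One N12 statement on numbers: `|X| = sX`, `|Y| = sY`, `|Z| = sZ`, volume `V`, translate bounds `ta, tc`, group order `n`:
the hypothesis `σ, σ' ≥ 1 ∧ (2σ > sX ∨ 2σ' > sY)` holds and EVERY divisor `e` of `n` admissible for (i) and (iii) violates the mass
inequality (ii).  Bounded divisor quantifier as in `N8Dead1` (decidable). [folklore] -/
def n12Stmt (n sX sY sZ V ta tc : ℕ) : Bool :=
  decide (2 * ta + n + 1 ≤ 2 * sX + sZ) && decide (2 * tc + n + 1 ≤ 2 * sY + sZ) &&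
    (decide (sX + 1 ≤ 2 * (2 * sX + sZ - (2 * ta + n))) || decide (sY + 1 ≤ 2 * (2 * sY + sZ - (2 * tc + n)))) &&
    decide (∀ e : ℕ, e < n + 1 → e ∣ n → 0 < e →
      n12Adm sX sY sZ (2 * sX + sZ - (2 * ta + n)) (2 * sY + sZ - (2 * tc + n)) e = true →
      V + (e - sZ) * min sX sY < sX * sY)

/-- **Filter N12, one rotation**, on the card vectors `(a, b, c)` of a pattern in a group of order `n` (`ta = max aᵢ`, `tc = max cᵢ`).
Same verdicts as HOME `pub-omega-stpp-1-g26/n12/n12_filter.py` (identity rotation). [folklore] -/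
def N12Dead1 (n N : ℕ) (a b c : Fin N → ℕ) : Bool :=
  n12Stmt n (∑ i, a i * b i) (∑ i, b i * c i) (∑ i, a i * c i) (∑ i, a i * b i * c i) (univ.sup a) (univ.sup c)

/-- **Filter N12** on the card vectors: `N12Dead1` for one of the three rotations `(a,b,c)`, `(b,c,a)`, `(c,a,b)`. [folklore] -/
def N12Dead (n N : ℕ) (a b c : Fin N → ℕ) : Bool := N12Dead1 n N a b c || N12Dead1 n N b c a || N12Dead1 n N c a b

variable [Fintype H] {N : ℕ} {A B C : Fin N → Finset H}

open Literature.Computability.AlgebraicComplexity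

/-- **Filter N12, one rotation (kernel).**  An STPP family with non-empty sets whose card vectors satisfy `N12Dead1 |H|` does not exist.
[cite: CohnKleinbergSzegedyUmans2005, Def. 5.1] -/
theorem not_isSTPP_of_n12Dead1 (hS : IsSTPP A B C) (hA : ∀ i, (A i).Nonempty) (hB : ∀ i, (B i).Nonempty)
    (hC : ∀ i, (C i).Nonempty) {n : ℕ} (hn : Fintype.card H = n) {a b c : Fin N → ℕ} (ha : ∀ i, #(A i) = a i)
    (hb : ∀ i, #(B i) = b i) (hc : ∀ i, #(C i) = c i) (hdead : N12Dead1 n N a b c = true) : False := by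
  simp only [N12Dead1, n12Stmt, Bool.and_eq_true, Bool.or_eq_true, decide_eq_true_eq] at hdead
  obtain ⟨⟨⟨h1, h2⟩, h3⟩, h4⟩ := hdead
  exact n12_rotation hS hA hB hC hn ha hb hc (fun i => le_sup (f := a) (mem_univ i))
    (fun i => le_sup (f := c) (mem_univ i)) h1 h2 h3 h4

/-- **Filter N12 (kernel): an STPP family with non-empty sets in a finite abelian group `H` whose pattern `(|Aᵢ|,|Bᵢ|,|Cᵢ|)ᵢ` is
`N12Dead |H|` does not exist** — the three rotations via `stpp_rotate`. [cite: CohnKleinbergSzegedyUmans2005, Def. 5.1] -/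
theorem not_isSTPP_of_n12Dead (hS : IsSTPP A B C) (hA : ∀ i, (A i).Nonempty) (hB : ∀ i, (B i).Nonempty)
    (hC : ∀ i, (C i).Nonempty) {n : ℕ} (hn : Fintype.card H = n) {a b c : Fin N → ℕ} (ha : ∀ i, #(A i) = a i)
    (hb : ∀ i, #(B i) = b i) (hc : ∀ i, #(C i) = c i) (hdead : N12Dead n N a b c = true) : False := by
  simp only [N12Dead, Bool.or_eq_true] at hdead
  rcases hdead with (h | h) | h
  · exact not_isSTPP_of_n12Dead1 hS hA hB hC hn ha hb hc h
  · exact not_isSTPP_of_n12Dead1 (stpp_rotate hS) hB hC hA hn hb hc ha h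
  · exact not_isSTPP_of_n12Dead1 (stpp_rotate (stpp_rotate hS)) hC hA hB hn hc ha hb h

/-- Card-vector form with literal vectors: non-emptiness from positivity of the entries. [cite: CohnKleinbergSzegedyUmans2005, Def. 5.1] -/
theorem not_isSTPP_of_n12Dead' (hS : IsSTPP A B C) {n : ℕ} (hn : Fintype.card H = n) (a b c : Fin N → ℕ)
    (ha : ∀ i, #(A i) = a i) (hb : ∀ i, #(B i) = b i) (hc : ∀ i, #(C i) = c i)
    (hpos : ∀ i, 0 < a i ∧ 0 < b i ∧ 0 < c i) (hdead : N12Dead n N a b c = true) : False :=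
  not_isSTPP_of_n12Dead hS (fun i => card_pos.1 ((ha i).symm ▸ (hpos i).1))
    (fun i => card_pos.1 ((hb i).symm ▸ (hpos i).2.1)) (fun i => card_pos.1 ((hc i).symm ▸ (hpos i).2.2))
    hn ha hb hc hdead

end Filter

/-! ## §4 Example: a ℤ₅₇ frontier leaf (alive under N7–N11) decided by N12 -/

section Examples

variable [Fintype H]

open Literature.Computability.AlgebraicComplexity

/-- The ℤ₅₇ frontier leaf `{(1,4,7), (3,2,2), (3,3,2)}` (`∑ abc = 58 > 57`; alive under the census filters N7–N11) carries no STPP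
family in ANY abelian group of order `57`: in the rotation `(C,A,B)` one has `|X| = |Y| = 19`, `|Z| = 38`, `σ = 5`, `σ' = 11 > 19/2`,
so `X − X = Y − Y` is a subgroup of order `e ∣ 57` with `e ≥ 38`, i.e. `e = 57`, and the energy `56·11 + 19 = 635 > 361 = 19²`.
[cite: CohnKleinbergSzegedyUmans2005, Def. 5.1] -/
theorem no_isSTPP_Z57_147_322_332 (hH : Fintype.card H = 57) (A B C : Fin 3 → Finset H) (hS : IsSTPP A B C)
    (hA : ∀ i, #(A i) = ![1, 3, 3] i) (hB : ∀ i, #(B i) = ![4, 2, 3] i) (hC : ∀ i, #(C i) = ![7, 2, 2] i) : False :=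
  not_isSTPP_of_n12Dead' hS hH _ _ _ hA hB hC (by decide) (by decide +kernel)

end Examples

end Summit.MatrixMultiplication.OmegaCensus.CubeNB
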